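import Summits.AnomalousDissipation.AnomalousDissipation.Theses.HopfSnake

/-!
# Line `selection` for the crux `BoundedSnakeToZero3D` (stmt-AnomalousDissipation-10640; piece 1 of the typed
decomposition of `BoundedLoudSnake`, stmt-AnomalousDissipation-1802, route HopfSnake)

Skeleton (crux-strategist, 2026-08-17): existence of a BOUNDED (d)-snake of a genuinely three-dimensional force
from

* `stub_snake3D` (engine output, conjecture-grade): SOME genuinely three-dimensional smooth steady divergence-free
  mean-zero force carries a (d)-snake at all (SnakeToZero, stmt-1799, with the 3-D side condition; no energy
  information): global Hopf bifurcation in `λ = log(1/ν)` from a Hopf point of the steady variety (Fiedler 1988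
  Thm 2.10 + Cor 2.13) with exits (a)–(c) excluded;
* `stub_boundedSelection3D` (selection law, conjecture-grade): every genuinely three-dimensional force that carries
  a (d)-snake carries one whose limsup-mean energies are bounded uniformly in `s` (not every escaping snake can follow
  the laminar scaling `E ~ ν⁻²`; Fuller-index count of escaping snake ends against the laminar branch);

composed in `BoundedSnakeToZero3D_proof`.  The composition is pure logic (∃/∀ cut): the content of this line is the
SEPARATION of the engine's output from the selection principle, each refutable on its own (a 3-D force all of whose
snakes are laminar-scaled kills stub 2 without touching stub 1).
-/

namespace Summit.AnomalousDissipation.AnomalousDissipation.Cruxes.BoundedLoudSnake.Selection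

/-- STUB 1 — A (d)-SNAKE OF A GENUINELY THREE-DIMENSIONAL FORCE EXISTS (engine output; no energy bound). -/
theorem stub_snake3D :
    ∃ f : UnitAddTorus (Fin 3) → EuclideanSpace ℝ (Fin 3), Literature.Analysis.FunctionSpaces.Torus.IsSmooth f ∧ Literature.Analysis.FunctionSpaces.Torus.IsDivFree f ∧ Literature.Analysis.FunctionSpaces.Torus.HasZeroMean f ∧ (∀ k : EuclideanSpace ℝ (Fin 3), k ≠ 0 → ∃ τ : ℝ, ∃ x, f (x + Literature.Analysis.FunctionSpaces.Torus.proj (τ • k)) ≠ f x) ∧ ∃ (ν : ℝ → ℝ) (u : ℝ → ℝ → UnitAddTorus (Fin 3) → EuclideanSpace ℝ (Fin 3)) (p : ℝ → ℝ → UnitAddTorus (Fin 3) → ℝ), (Continuous ν ∧ Continuous (fun q : ℝ × ℝ × UnitAddTorus (Fin 3) => u q.1 q.2.1 q.2.2) ∧ (∀ s, 0 < ν s ∧ Literature.Analysis.FunctionSpaces.Torus.IsClassicalNSSolutionOn Set.univ (ν s) (fun _ => f) (u s) (p s) ∧ (∀ t, Literature.Analysis.FunctionSpaces.Torus.HasZeroMean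 (u s t)) ∧ (∃ T, 0 < T ∧ Function.Periodic (u s) T) ∧ (∃ t, Literature.Analysis.FunctionSpaces.Torus.kineticEnergy (u s t) ≠ Literature.Analysis.FunctionSpaces.Torus.kineticEnergy (u s 0))) ∧ (∀ ν₀, 0 < ν₀ → ∃ s, ν s < ν₀) ∧ (∀ ν₁, 0 < ν₁ → ∃ M, ∀ s, ν₁ ≤ ν s → (∃ T, 0 < T ∧ T ≤ M ∧ Function.Periodic (u s) T) ∧ ∀ t, Literature.Analysis.FunctionSpaces.Torus.gradNormSq (u s t) ≤ M)) := by
  sorry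

/-- STUB 2 — BOUNDED SELECTION LAW: a genuinely three-dimensional force that carries a (d)-snake carries a bounded
one (limsup-mean energies bounded uniformly along the snake). -/
theorem stub_boundedSelection3D :
    ∀ f : UnitAddTorus (Fin 3) → EuclideanSpace ℝ (Fin 3), Literature.Analysis.FunctionSpaces.Torus.IsSmooth f → Literature.Analysis.FunctionSpaces.Torus.IsDivFree f → Literature.Analysis.FunctionSpaces.Torus.HasZeroMean f → (∀ k : EuclideanSpace ℝ (Fin 3), k ≠ 0 → ∃ τ : ℝ, ∃ x, f (x + Literature.Analysis.FunctionSpaces.Torus.proj (τ • k)) ≠ f x) → (∃ (ν : ℝ → ℝ) (u : ℝ → ℝ → UnitAddTorus (Fin 3) → EuclideanSpace ℝ (Fin 3)) (p : ℝ → ℝ → UnitAddTorus (Fin 3) → ℝ), (Continuous ν ∧ Continuous (fun q : ℝ × ℝ × UnitAddTorus (Fin 3) => u q.1 q.2.1 q.2.2) ∧ (∀ s, 0 < ν s ∧ Literature.Analysis.FunctionSpaces.Torus.IsClassicalNSSolutionOn Set.univ (ν s) (fun _ => f) (u s) (p s) ∧ (∀ t, Literature.Analysis.FunctionSpaces.Torus.HasZeroMean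 (u s t)) ∧ (∃ T, 0 < T ∧ Function.Periodic (u s) T) ∧ (∃ t, Literature.Analysis.FunctionSpaces.Torus.kineticEnergy (u s t) ≠ Literature.Analysis.FunctionSpaces.Torus.kineticEnergy (u s 0))) ∧ (∀ ν₀, 0 < ν₀ → ∃ s, ν s < ν₀) ∧ (∀ ν₁, 0 < ν₁ → ∃ M, ∀ s, ν₁ ≤ ν s → (∃ T, 0 < T ∧ T ≤ M ∧ Function.Periodic (u s) T) ∧ ∀ t, Literature.Analysis.FunctionSpaces.Torus.gradNormSq (u s t) ≤ M))) → ∃ (ν : ℝ → ℝ) (u : ℝ → ℝ → UnitAddTorus (Fin 3) → EuclideanSpace ℝ (Fin 3)) (p : ℝ → ℝ → UnitAddTorus (Fin 3) → ℝ), (Continuous ν ∧ Continuous (fun q : ℝ × ℝ × UnitAddTorus (Fin 3) => u q.1 q.2.1 q.2.2) ∧ (∀ s, 0 < ν s ∧ Literature.Analysis.FunctionSpaces.Torus.IsClassicalNSSolutionOn Set.univ (ν s) (fun _ => f) (u s) (p s) ∧ (∀ t, Literature.Analysis.FunctionSpaces.Torus.HasZeroMean (u s t)) ∧ (∃ T,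 0 < T ∧ Function.Periodic (u s) T) ∧ (∃ t, Literature.Analysis.FunctionSpaces.Torus.kineticEnergy (u s t) ≠ Literature.Analysis.FunctionSpaces.Torus.kineticEnergy (u s 0))) ∧ (∀ ν₀, 0 < ν₀ → ∃ s, ν s < ν₀) ∧ (∀ ν₁, 0 < ν₁ → ∃ M, ∀ s, ν₁ ≤ ν s → (∃ T, 0 < T ∧ T ≤ M ∧ Function.Periodic (u s) T) ∧ ∀ t, Literature.Analysis.FunctionSpaces.Torus.gradNormSq (u s t) ≤ M)) ∧ ∃ E : ℝ, ∀ s, Literature.Analysis.FluidPDE.meanEnergy (u s) ≤ E := by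
  sorry

/-- COMPOSITION (kernel-checked, no sorry of its own): the two stubs give the crux `BoundedSnakeToZero3D`
BY NAME. -/
theorem BoundedSnakeToZero3D_proof :
    Summit.AnomalousDissipation.AnomalousDissipation.Theses.HopfSnake.BoundedSnakeToZero3D := by
  obtain ⟨f, hf, hdiv, hmean, h3d, hsn⟩ := stub_snake3D
  obtain ⟨ν, u, p, hsnake, hE⟩ := stub_boundedSelection3D f hf hdiv hmean h3d hsn
  exact ⟨f, hf, hdiv, hmean, h3d, ν, u, p, hsnake, hE⟩

end Summit.AnomalousDissipation.AnomalousDissipation.Cruxes.BoundedLoudSnake.Selection
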